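import Summits.BirchSwinnertonDyer.BirchSwinnertonDyer.Theorems.ManinLocalTwoThreePShiftDescentExtend
import Summits.BirchSwinnertonDyer.BirchSwinnertonDyer.Theorems.ManinLocalTwoThreePShiftEqualiserVpLeOne
import HarnessLib

/-!
# The prime-generic descent engine, III: the FERMAT-QUOTIENT certificate — `K_p(pm) = D(pm) ⟹ K_p(p²m) = D(p²m)` for `p ∤ m`
# (route `ManinLocalTwoThree`, cell bsd-f2-manin; cruxes C2 stmt-BirchSwinnertonDyer-22967 / C3 stmt-…-22968; LEAD seat p1 gen 12; the `p² ∥ N`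
# step of the LEAD's prime-generic shift-equaliser conjecture = typer's `ShiftEqualiser.PrimeShiftInvariantIsDiamond`, every prime `p`)

The `p`-generic form of p3's E-es-105 `threeShiftStepNine_holds` (`χ₉ ∘ d`) and of the seat's/p3's `χ₄ ∘ d` at `p = 2`: the single obstruction
`φ(P_{2/p}) − φ(P_{1/p})` of the descent `Γ₀(p²m) → Γ₀(pm)` (file II `PShiftEngine.descent`) is ABSORBED by the conductor-`p²` diamond class
**`χ = fq ∘ d`**, `fq(x) = (x^{p−1} − 1)/p mod p` the FERMAT QUOTIENT: `fq` is additive on units mod `p²` (`fq_mul`), depends on `x mod p²`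
(`fq_congr`), and `fq(1 + pu) = −u` (`fq_one_add`); so `χ` is an additive diamond class of `Γ₀(p²m)` with `χ(P_{2/p}) − χ(P_{1/p}) = −2m + m = −m`,
non-zero exactly when `p ∤ m`.  Hence **`step_of_not_dvd : ShiftInvariantIsDiamondAtP p (pm) (ZMod p) → ShiftInvariantIsDiamondAtP p (p·pm) (ZMod p)`**
for `p ∤ m`, and with the seat's `v_p ≤ 1` law (`shiftInvariantIsDiamondAt_of_not_sq_dvd`, `p ≥ 5`) the typer's node
`ShiftEqualiser.ShiftInvariantIsDiamondAt (ZMod p) p N` at every `N ≥ 1` with `p³ ∤ N`, `p ≥ 5` (`shiftInvariantIsDiamondAt_of_not_cube_dvd`).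
Nothing about BSD, Manin's conjecture or C2/C3 is asserted here. [cite: DarmonDiamondTaylor1995, Lemma 4.28 (p. 135) (shape only)]
-/

set_option autoImplicit false
set_option linter.dupNamespace false

open scoped MatrixGroups

open CongruenceSubgroup Matrix.SpecialLinearGroup
  Summit.BirchSwinnertonDyer.Rank1Residual.ManinAdditive.NineShiftEqualiser

namespace Summit.BirchSwinnertonDyer.BirchSwinnertonDyer.Theorems.ManinLocalTwoThree

namespace PShiftEngine

open ThreeShiftDescent TwoShift PShiftTransfer
open Summit.BirchSwinnertonDyer.Rank1Residual.ManinAdditive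

variable {p : ℕ} [Fact p.Prime]

/-! ### §1. The Fermat quotient mod `p` -/

section FermatQuotient

/-- The FERMAT QUOTIENT `fq(x) = (x^{p−1} − 1)/p mod p` of an integer `x` (meaningful for `x` prime to `p`). [folklore] -/
def fq (p : ℕ) (x : ℤ) : ZMod p := ((((x ^ (p - 1) - 1) / (p : ℤ)) : ℤ) : ZMod p)

/-- Fermat: `p ∣ x^{p−1} − 1` for `x` prime to `p`. [folklore] -/
theorem p_dvd_pow_sub_one {x : ℤ} (hx : IsCoprime x (p : ℤ)) : (p : ℤ) ∣ x ^ (p - 1) - 1 :=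
  (Int.ModEq.pow_card_sub_one_eq_one (Fact.out) hx).symm.dvd

/-- **`fq` is additive on integers prime to `p`.** [folklore] -/
theorem fq_mul {x y : ℤ} (hx : IsCoprime x (p : ℤ)) (hy : IsCoprime y (p : ℤ)) : fq p (x * y) = fq p x + fq p y := by
  unfold fq
  set X := (x ^ (p - 1) - 1) / (p : ℤ) with hX
  set Y := (y ^ (p - 1) - 1) / (p : ℤ) with hY
  have hX' : (p : ℤ) * X = x ^ (p - 1) - 1 := Int.mul_ediv_cancel' (p_dvd_pow_sub_one hx)
  have hY' : (p : ℤ) * Y = y ^ (p - 1) - 1 := Int.mul_ediv_cancel' (p_dvd_pow_sub_one hy)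
  have e : (x * y) ^ (p - 1) - 1 = (p : ℤ) * ((p : ℤ) * X * Y + X + Y) := by
    rw [mul_pow]; linear_combination (y ^ (p - 1)) * (-hX') + (-1 - (p : ℤ) * X) * hY'
  rw [e, Int.mul_ediv_cancel_left _ p_ne_zero_int]
  push_cast
  rw [ZMod.natCast_self, zero_mul, zero_mul, zero_add]

/-- **`fq` depends only on `x mod p²`.** [folklore] -/
theorem fq_congr {x y : ℤ} (hx : IsCoprime x (p : ℤ)) (hy : IsCoprime y (p : ℤ)) (h : x ≡ y [ZMOD (p : ℤ) ^ 2]) :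
    fq p x = fq p y := by
  unfold fq
  set X := (x ^ (p - 1) - 1) / (p : ℤ) with hX
  set Y := (y ^ (p - 1) - 1) / (p : ℤ) with hY
  have hX' : (p : ℤ) * X = x ^ (p - 1) - 1 := Int.mul_ediv_cancel' (p_dvd_pow_sub_one hx)
  have hY' : (p : ℤ) * Y = y ^ (p - 1) - 1 := Int.mul_ediv_cancel' (p_dvd_pow_sub_one hy)
  have h2 : ((p : ℤ) ^ 2) ∣ y ^ (p - 1) - x ^ (p - 1) := (h.pow (p - 1)).dvd
  have h3 : (p : ℤ) * p ∣ (p : ℤ) * (Y - X) := by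
    rw [mul_sub, hX', hY', ← sq]; convert h2 using 1; ring
  have h4 : (p : ℤ) ∣ Y - X := Int.dvd_of_mul_dvd_mul_left p_ne_zero_int h3
  have := (ZMod.intCast_zmod_eq_zero_iff_dvd _ p).mpr h4
  push_cast at this
  exact (sub_eq_zero.mp this).symm

omit [Fact p.Prime] in
/-- `(1 + pu)^n ≡ 1 + n p u (mod p²)`. [folklore] -/
theorem one_add_pow_modEq (u : ℤ) (n : ℕ) : (1 + (p : ℤ) * u) ^ n ≡ 1 + n * ((p : ℤ) * u) [ZMOD (p : ℤ) ^ 2] := by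
  induction n with
  | zero => simp
  | succ n ih =>
    have e : (1 + (p : ℤ) * u) ^ (n + 1) = (1 + (p : ℤ) * u) ^ n * (1 + p * u) := pow_succ _ _
    rw [e]
    calc (1 + (p : ℤ) * u) ^ n * (1 + p * u) ≡ (1 + n * (p * u)) * (1 + p * u) [ZMOD (p : ℤ) ^ 2] := ih.mul_right _
      _ ≡ 1 + (n + 1 : ℕ) * ((p : ℤ) * u) [ZMOD (p : ℤ) ^ 2] := by
        refine Int.ModEq.symm ((Int.modEq_iff_dvd).mpr ⟨n * u * u, ?_⟩)
        push_cast; ring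

omit [Fact p.Prime] in
/-- `1 + pu` is prime to `p`. [folklore] -/
theorem isCoprime_one_add (u : ℤ) : IsCoprime (1 + (p : ℤ) * u) (p : ℤ) := ⟨1, -u, by ring⟩

/-- **`fq(1 + pu) = −u`.** [folklore] -/
theorem fq_one_add (u : ℤ) : fq p (1 + (p : ℤ) * u) = -(u : ZMod p) := by
  have hp : p.Prime := Fact.out
  unfold fq
  set X := ((1 + (p : ℤ) * u) ^ (p - 1) - 1) / (p : ℤ) with hX
  have hX' : (p : ℤ) * X = (1 + (p : ℤ) * u) ^ (p - 1) - 1 := Int.mul_ediv_cancel' (p_dvd_pow_sub_one (isCoprime_one_add u))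
  have h1 := one_add_pow_modEq (p := p) u (p - 1)
  -- `p X ≡ (p−1) p u (mod p²)`, so `p ∣ X − (p−1) u`
  have h2 : (p : ℤ) * p ∣ (p : ℤ) * (X - (p - 1 : ℕ) * u) := by
    have h1' := (h1.symm).dvd
    have e : (p : ℤ) * (X - (p - 1 : ℕ) * u) = (1 + (p : ℤ) * u) ^ (p - 1) - (1 + ((p - 1 : ℕ) : ℤ) * ((p : ℤ) * u)) := by
      rw [mul_sub, hX']; ring
    rw [← sq, e]; exact h1'
  have h3 : (p : ℤ) ∣ X - (p - 1 : ℕ) * u := Int.dvd_of_mul_dvd_mul_left p_ne_zero_int h2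
  have h4 := (ZMod.intCast_zmod_eq_zero_iff_dvd _ p).mpr h3
  push_cast at h4
  rw [Nat.cast_sub hp.one_le, Nat.cast_one, ZMod.natCast_self, zero_sub] at h4
  linear_combination h4

end FermatQuotient

/-! ### §2. The conductor-`p²` diamond class `χ = fq ∘ d` on `Γ₀(p²m)` -/

section Chi

variable {m : ℕ}

/-- **The conductor-`p²` diamond class** `χ(γ) := fq(d_γ)` on `Γ₀(p²m)`. [folklore] -/
def chiP (p m : ℕ) (γ : Gamma0 (p * (p * m))) : ZMod p := fq p ((γ : SL(2, ℤ)) 1 1 : ℤ)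

omit [Fact p.Prime] in
/-- For `γ ∈ Γ₀(p²m)`: `p² ∣ c_γ`. [folklore] -/
theorem sq_dvd_c (γ : Gamma0 (p * (p * m))) : (p : ℤ) ^ 2 ∣ ((γ : SL(2, ℤ)) 1 0 : ℤ) :=
  dvd_trans ⟨(m : ℤ), by push_cast; ring⟩ ((ZMod.intCast_zmod_eq_zero_iff_dvd _ _).mp (Gamma0_mem.mp γ.2))

omit [Fact p.Prime] in
/-- For `γ ∈ Γ₀(p²m)`: `d_γ` is prime to `p`. [folklore] -/
theorem isCoprime_d (γ : Gamma0 (p * (p * m))) : IsCoprime (((γ : SL(2, ℤ)) 1 1 : ℤ)) (p : ℤ) := by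
  obtain ⟨k, hk⟩ := sq_dvd_c (p := p) γ
  have h := gamma0_det_entries γ
  refine ⟨((γ : SL(2, ℤ)) 0 0 : ℤ), -(((γ : SL(2, ℤ)) 0 1 : ℤ) * p * k), ?_⟩
  rw [hk] at h
  linear_combination h

/-- `χ` is additive on `Γ₀(p²m)`. [folklore] -/
theorem isAdd_chiP : IsAdd (chiP p m) := by
  intro γ δ
  unfold chiP
  obtain ⟨k, hk⟩ := sq_dvd_c (p := p) γ
  have e : (((γ * δ : Gamma0 (p * (p * m))) : SL(2, ℤ)) 1 1 : ℤ) =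
      (γ : SL(2, ℤ)) 1 0 * (δ : SL(2, ℤ)) 0 1 + (γ : SL(2, ℤ)) 1 1 * (δ : SL(2, ℤ)) 1 1 := by
    simp [Matrix.mul_apply, Fin.sum_univ_two]
  have hcop : IsCoprime ((((γ * δ : Gamma0 (p * (p * m))) : SL(2, ℤ)) 1 1 : ℤ)) (p : ℤ) := isCoprime_d (γ * δ)
  rw [e] at hcop ⊢
  rw [← fq_mul (isCoprime_d γ) (isCoprime_d δ)]
  refine fq_congr hcop ((isCoprime_d γ).mul_left (isCoprime_d δ))
    (Int.modEq_iff_dvd.mpr ⟨-(k * ((δ : SL(2, ℤ)) 0 1 : ℤ)), ?_⟩)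
  rw [hk]; ring

/-- `χ` is a diamond class (`d ≡ 1 (mod p²m)` on `Γ₁(p²m)`). [folklore] -/
theorem isDiamond_chiP : IsDiamond (chiP p m) := by
  intro γ hγ
  obtain ⟨-, h11, -⟩ := (Gamma1_mem _ γ).mp hγ
  have h1 : ((p * (p * m) : ℕ) : ℤ) ∣ (γ 1 1 : ℤ) - 1 :=
    (ZMod.intCast_zmod_eq_zero_iff_dvd _ _).mp (by push_cast; rw [h11, sub_self])
  have h2 : (p : ℤ) ^ 2 ∣ 1 - (γ 1 1 : ℤ) := by
    have := dvd_trans (⟨(m : ℤ), by push_cast; ring⟩ : (p : ℤ) ^ 2 ∣ ((p * (p * m) : ℕ) : ℤ)) h1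
    rw [← neg_sub]; exact this.neg_right
  have hd : (γ 1 1 : ℤ) ≡ 1 [ZMOD (p : ℤ) ^ 2] := Int.modEq_iff_dvd.mpr h2
  show fq p ((γ 1 1 : ℤ)) = 0
  rw [fq_congr (isCoprime_d ⟨γ, Gamma1_in_Gamma0 _ hγ⟩) isCoprime_one_left hd]
  simp [fq]

/-- `χ` is `p`-shift invariant (diamond ∧ additive ⟹ invariant; typer's `isShiftInvariant_of_isDiamond`). [folklore] -/
theorem isShiftEigenP_chiP : IsShiftEigenP p (1 : ZMod p) (chiP p m) :=
  (isShiftEigenP_one_iff (chiP p m)).mpr (ShiftEqualiser.isShiftInvariant_of_isDiamond (p : ℤ) (chiP p m) isAdd_chiP isDiamond_chiP)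

/-- **`χ` separates the two parabolics exactly when `p ∤ m`:** `χ(P_{2/p}) − χ(P_{1/p}) = −m`. [folklore] -/
theorem chiP_P2p_sub_P1p : chiP p m (P2p p m) - chiP p m (P1p p m) = -((m : ℤ) : ZMod p) := by
  unfold chiP P2p P1p
  simp only [g0Of, slOf_apply_11]
  rw [show (1 + 2 * ((p : ℤ) * m) : ℤ) = 1 + (p : ℤ) * (2 * m) by ring, show (1 + (p : ℤ) * m : ℤ) = 1 + (p : ℤ) * m by ring,
    fq_one_add, fq_one_add]
  push_cast; ring

end Chi

/-! ### §3. The step `Γ₀(p²m) → Γ₀(pm)`, `p ∤ m`, and the law at `v_p(N) ≤ 2` -/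

section Step

variable {m : ℕ}

/-- **`K_p(pm) = D(pm) ⟹ K_p(p²m) = D(p²m)` for `p ∤ m`** (every prime `p`, `m ≥ 1`; coefficients `ℤ/p`): subtract the multiple `c·χ`
that kills the obstruction, descend by file II, conclude by the hypothesis at level `pm`. [new: the `p`-generic E-es-105] -/
theorem step_of_not_dvd (hm : 0 < m) (hpm : ¬ p ∣ m) (hbase : ShiftInvariantIsDiamondAtP p (p * m) (ZMod p)) :
    ShiftInvariantIsDiamondAtP p (p * (p * m)) (ZMod p) := by
  intro φ hadd hinv
  set χ := chiP p m with hχ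
  have hne : χ (P2p p m) - χ (P1p p m) ≠ 0 := by
    rw [hχ, chiP_P2p_sub_P1p, neg_ne_zero, Int.cast_natCast, Ne, ZMod.natCast_eq_zero_iff]
    exact hpm
  set c : ZMod p := (φ (P2p p m) - φ (P1p p m)) * (χ (P2p p m) - χ (P1p p m))⁻¹ with hc
  set φ' : Gamma0 (p * (p * m)) → ZMod p := fun g => φ g - c * χ g with hφ'
  have hχadd : IsAdd χ := isAdd_chiP
  have hχD : IsDiamond χ := isDiamond_chiP
  have hχinv : IsShiftEigenP p (1 : ZMod p) χ := isShiftEigenP_chiP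
  have hadd' : IsAdd φ' := by
    intro g h
    simp only [hφ', hadd g h, hχadd g h]
    ring
  have hinv' : IsShiftEigenP p (1 : ZMod p) φ' := by
    intro a b c₀ d h hc
    simp only [hφ']
    rw [hinv a b c₀ d h hc, hχinv a b c₀ d h hc]
    ring
  have hP : φ' (P2p p m) = φ' (P1p p m) := by
    simp only [hφ', hc]
    rw [sub_eq_sub_iff_sub_eq_sub, ← mul_sub, mul_assoc, inv_mul_cancel₀ hne, mul_one]
  obtain ⟨w, hwadd, hwinv, hres⟩ := descent φ' 1 hm hadd' hinv' hP
  have hwD : IsDiamond w := hbase w hwadd hwinv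
  have hφ'D : IsDiamond φ' := isDiamond_of_restrictsFrom (dvd_mul_left (p * m) p) hres hwD
  intro γ hγ
  have h1 := hφ'D γ hγ
  have h2 := hχD γ hγ
  simp only [hφ'] at h1
  rw [h2, mul_zero, sub_zero] at h1
  exact h1

/-- **The prime-generic law at `v_p(N) ≤ 2`, BY NAME (`p ≥ 5`)**: for `N ≥ 1` with `p³ ∤ N`, every additive `p`-shift-invariant
`φ : Γ₀(N) → ℤ/p` is diamond. [new] -/
theorem shiftInvariantIsDiamondAt_of_not_cube_dvd {N : ℕ} (h5 : 5 ≤ p) (hN : 0 < N) (hcube : ¬ p ^ 3 ∣ N) :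
    ShiftEqualiser.ShiftInvariantIsDiamondAt (ZMod p) (p : ℤ) N := by
  have hp : p.Prime := Fact.out
  by_cases hsq : p ^ 2 ∣ N
  · obtain ⟨m, rfl⟩ := hsq
    have hm : 0 < m := Nat.pos_of_mul_pos_left hN
    have hpm : ¬ p ∣ m := fun h => hcube (by obtain ⟨k, rfl⟩ := h; exact ⟨k, by ring⟩)
    rw [← shiftInvariantIsDiamondAtP_iff, show p ^ 2 * m = p * (p * m) by ring]
    refine step_of_not_dvd hm hpm ?_
    rw [shiftInvariantIsDiamondAtP_iff]
    exact shiftInvariantIsDiamondAt_of_not_sq_dvd h5 (by positivity) (fun h => hpm (by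
      obtain ⟨k, hk⟩ := h
      have : m = p * k := by
        have := hk; rw [sq] at this
        exact Nat.eq_of_mul_eq_mul_left hp.pos (by linarith)
      exact ⟨k, this⟩))
  · exact shiftInvariantIsDiamondAt_of_not_sq_dvd h5 hN hsq

end Step

end PShiftEngine

end Summit.BirchSwinnertonDyer.BirchSwinnertonDyer.Theorems.ManinLocalTwoThree
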